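import Mathlib
import Literature.Analysis.FluidPDE.VectorCalculus
import Literature.Analysis.FluidPDE.LeiZhang2011Proofs
import Literature.Analysis.FluidPDE.DifferentiableGaussGreen
import Literature.Analysis.FluidPDE.TaoAveragedNondegeneracy
import Summits.NavierStokesRegularity.NavierStokesRegularity.Theorems.FilamentSkeletonRssSkeletonEquilibriumTameVerticalToolsA
import Summits.NavierStokesRegularity.NavierStokesRegularity.Theorems.FilamentSkeletonRssSkeletonEquilibriumTameVerticalToolsB
import Summits.NavierStokesRegularity.NavierStokesRegularity.Theorems.FilamentSkeletonRssSkeletonEquilibriumTameVerticalToolsC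

/-!
# Axial strain of the self filament (stub `stub_strainSelfFilament`, D2, line `zero-accretion-selection`)

Endgame of the negation line of crux `SkeletonEquilibrium` (thesis `FilamentSkeletonRss`): after the slope
formula (landed `stub_slopeFormula`) we bound `∫ I` for the filament THROUGH the stagnation point `x₀ = X τs`,
`I(σ) = −3((‖r‖²+1)^{5/2})⁻¹⟪r, T₀⟫⟪X′σ × r, T₀⟫`, `r = x₀ − X σ`, `T₀ = X′ τs`. Proof: `|I| ≤ 3((‖r‖²+1)^{3/2})⁻¹`
(ToolsA) gives integrability (ToolsC); split `ℝ` into the far field (ToolsC tail: `≤ 12C₀/(R²Γ)`), the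
returning strands (chord–arc forces `‖r‖ ≥ ρ′√Γ` outside the window `|σ − τs| < 2ρ′√Γ`, verticality gives the
tilt `≤ 3θ`: `≤ 9θC₀R/(ρ′³Γ)`), and the window, where `⟪X′σ × r, T₀⟫ = −⟪T₀ × (X′σ − T₀), Xσ − x₀ − sT₀⟫` is
controlled by the coherent-bending cancellation `selfStrand_triple_le` (ToolsB) and the chord from below by
verticality + mean value theorem (`‖r‖² ≥ (3/4)s²`); the majorant `c₁ + c₂(√(1+s²))⁻¹` integrates to an `arsinh`.
-/

noncomputable section

open MeasureTheory Set Literature.Analysis.FluidPDE Literature.Analysis.FluidPDE.Tao2016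
open scoped RealInnerProductSpace InnerProductSpace

namespace Summit.NavierStokesRegularity.NavierStokesRegularity.Theorems.SkeletonEquilibrium.ZeroAccretionSelection
set_option linter.dupNamespace false

/-- Self-strand form of the numerator: `⟪P × (x₀ − x), T₀⟫ = −⟪T₀ × (P − T₀), x − x₀ − s T₀⟫`. [folklore] -/
private theorem sssf_triple_identity (P T₀ x x₀ : EuclideanSpace ℝ (Fin 3)) (s : ℝ) :
    ⟪cross P (x₀ - x), T₀⟫ = -⟪cross T₀ (P - T₀), x - x₀ - s • T₀⟫ := by
  simp only [real_inner_fin3, cross_apply_zero, cross_apply_one, cross_apply_two, PiLp.sub_apply,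
    PiLp.smul_apply, smul_eq_mul]
  ring

/-- A unit-speed `C²` curve is `1`-Lipschitz: `‖X u − X v‖ ≤ |u − v|`. [folklore] -/
private theorem sssf_lip {X : ℝ → EuclideanSpace ℝ (Fin 3)} (hX : ContDiff ℝ 2 X)
    (hunit : ∀ σ, ‖deriv X σ‖ = 1) (u v : ℝ) : ‖X u - X v‖ ≤ |u - v| := by
  have hd : Differentiable ℝ X := hX.differentiable (by norm_num)
  simpa [Real.norm_eq_abs] using convex_univ.norm_image_sub_le_of_norm_deriv_le (f := X)
    (fun x _ => hd x) (fun x _ => (hunit x).le) (mem_univ v) (mem_univ u)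

/-- A `θ`-vertical unit vector with `θ ≤ 1/2` has squared height `⟪a, e⟫² ≥ 3/4` (Lagrange). [folklore] -/
private theorem sssf_height_sq {a e : EuclideanSpace ℝ (Fin 3)} (ha : ‖a‖ = 1) (he : ‖e‖ = 1) {θ : ℝ}
    (hθ : θ ≤ 1 / 2) (hae : ‖cross a e‖ ≤ θ) : 3 / 4 ≤ ⟪a, e⟫ ^ 2 := by
  have h := norm_cross_sq a e
  rw [ha, he] at h
  nlinarith [norm_nonneg (cross a e)]

/-- **Chord lower bound from verticality.** If `⟪X′ ξ, e⟫² ≥ 3/4` (`e` unit) strictly between `a < b`,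
then `(3/4)(b − a)² ≤ ‖X b − X a‖²` (mean value theorem for `u ↦ ⟪X u, e⟫`, Cauchy–Schwarz). [folklore] -/
private theorem sssf_chord {X : ℝ → EuclideanSpace ℝ (Fin 3)} (hX : ContDiff ℝ 2 X)
    {e : EuclideanSpace ℝ (Fin 3)} (he : ‖e‖ = 1) {a b : ℝ} (hab : a < b)
    (hvert : ∀ ξ ∈ Ioo a b, 3 / 4 ≤ ⟪deriv X ξ, e⟫ ^ 2) : 3 / 4 * (b - a) ^ 2 ≤ ‖X b - X a‖ ^ 2 := by
  have hd : Differentiable ℝ X := hX.differentiable (by norm_num)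
  have hderiv : ∀ x ∈ Ioo a b, HasDerivAt (fun u => ⟪X u, e⟫) ⟪deriv X x, e⟫ x := fun x _ => by
    simpa using ((hd x).hasDerivAt).inner ℝ (hasDerivAt_const x e)
  obtain ⟨c, hc, hslope⟩ := exists_hasDerivAt_eq_slope (fun u => ⟪X u, e⟫) (fun x => ⟪deriv X x, e⟫)
    hab (hX.continuous.inner continuous_const).continuousOn hderiv
  have hcs : |⟪X b - X a, e⟫| ≤ ‖X b - X a‖ := by simpa [he] using abs_real_inner_le_norm (X b - X a) e
  have hdiff : ⟪X b - X a, e⟫ = ⟪deriv X c, e⟫ * (b - a) := by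
    rw [inner_sub_left, hslope, div_mul_cancel₀ _ (sub_ne_zero.2 hab.ne')]
  have hsq := pow_le_pow_left₀ (abs_nonneg _) hcs 2
  rw [sq_abs, hdiff, mul_pow] at hsq
  exact (mul_le_mul_of_nonneg_right (hvert c hc) (sq_nonneg _)).trans hsq

-- adapted from …/Theorems/FilamentSkeletonRssSkeletonEquilibriumTameVerticalToolsC.lean (`stvc_kernel_le_of_le`, private)
/-- Cubic decay of the regularised kernel: `((‖z‖² + 1)^{3/2})⁻¹ ≤ B⁻³` for `0 < B ≤ ‖z‖`. [folklore] -/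
private theorem sssf_kernel_le_of_le {z : EuclideanSpace ℝ (Fin 3)} {B : ℝ} (hB : 0 < B)
    (hz : B ≤ ‖z‖) : ((‖z‖ ^ 2 + 1) ^ (3 / 2 : ℝ))⁻¹ ≤ (B ^ 3)⁻¹ := by
  refine inv_anti₀ (pow_pos hB 3) ?_
  calc B ^ 3 ≤ ‖z‖ ^ 3 := pow_le_pow_left₀ hB.le hz 3
    _ = (‖z‖ ^ 2) ^ (3 / 2 : ℝ) := by
        rw [← Real.rpow_natCast ‖z‖ 3, ← Real.rpow_natCast ‖z‖ 2, ← Real.rpow_mul (norm_nonneg _)]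
        norm_num
    _ ≤ (‖z‖ ^ 2 + 1) ^ (3 / 2 : ℝ) :=
        Real.rpow_le_rpow (sq_nonneg _) (le_add_of_nonneg_right zero_le_one) (by norm_num)

/-- **The self-strand majorant.** For `0 ≤ t ≤ ℓ`, `M ≥ 0`, `0 ≤ ε ≤ 1`, the bound of
`selfStrand_triple_le` is at most `(M+1)²/2 · t⁴/ℓ³ + (M+1) ε t³/ℓ²`. [folklore] -/
private theorem sssf_majorant_le {t ℓ M ε : ℝ} (ht : 0 ≤ t) (hℓ : 0 < ℓ) (htℓ : t ≤ ℓ) (hM : 0 ≤ M)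
    (hε : 0 ≤ ε) (hε1 : ε ≤ 1) :
    t * (M / ℓ) * ((M * t ^ 3 / (6 * ℓ) + ε * t ^ 2 / 2) / ℓ) +
        t ^ 2 / 2 * ((M * t ^ 2 / (2 * ℓ) + ε * t) / ℓ) * (M / ℓ) +
        ((M * t ^ 2 / (2 * ℓ) + ε * t) / ℓ) * ((M * t ^ 3 / (6 * ℓ) + ε * t ^ 2 / 2) / ℓ) ≤
      (M + 1) ^ 2 / 2 * t ^ 4 / ℓ ^ 3 + (M + 1) * ε * t ^ 3 / ℓ ^ 2 := by
  have hℓ0 : ℓ ≠ 0 := hℓ.ne'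
  have key : (M + 1) ^ 2 / 2 * t ^ 4 / ℓ ^ 3 + (M + 1) * ε * t ^ 3 / ℓ ^ 2 -
      (t * (M / ℓ) * ((M * t ^ 3 / (6 * ℓ) + ε * t ^ 2 / 2) / ℓ) +
        t ^ 2 / 2 * ((M * t ^ 2 / (2 * ℓ) + ε * t) / ℓ) * (M / ℓ) +
        ((M * t ^ 2 / (2 * ℓ) + ε * t) / ℓ) * ((M * t ^ 3 / (6 * ℓ) + ε * t ^ 2 / 2) / ℓ)) =
      (M ^ 2 / 12 * t ^ 4 * (ℓ - t) + t ^ 4 * ℓ * M * (1 - 5 * ε / 12) + t ^ 4 * ℓ / 2 +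
        t ^ 3 * ℓ ^ 2 * ε * (1 - ε / 2)) / ℓ ^ 4 := by
    field_simp
    ring
  rw [← sub_nonneg, key]
  have h1 : 0 ≤ ℓ - t := sub_nonneg.2 htℓ
  have h2 : 0 ≤ 1 - 5 * ε / 12 := by linarith
  have h3 : 0 ≤ 1 - ε / 2 := by linarith
  positivity

/-- **Self-window pointwise bound.** With `T₀ = X′ τs`, `r = X τs − X(τs+s)`, `|s| ≤ ℓ`: if along `|u| ≤ |s|`
the tangent has squared height `≥ 3/4` and the outer-scale `C²` control holds, then
`|I(τs+s)| ≤ 10(M+1)²/(3ℓ³) + 20(M+1)ε/(3ℓ²)(√(1+s²))⁻¹` (`selfStrand_triple_le`, `sssf_chord`). [folklore] -/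
private theorem sssf_window_pointwise {X : ℝ → EuclideanSpace ℝ (Fin 3)} (hX : ContDiff ℝ 2 X)
    (hunit : ∀ σ, ‖deriv X σ‖ = 1) {τs ℓ M ε s : ℝ} (hℓ : 0 < ℓ) (hM : 0 ≤ M) (hε : 0 ≤ ε)
    (hε1 : ε ≤ 1) (hsℓ : |s| ≤ ℓ)
    (hvert : ∀ u, |u| ≤ |s| →
      3 / 4 ≤ ⟪deriv X (τs + u), (EuclideanSpace.single 2 1 : EuclideanSpace ℝ (Fin 3))⟫ ^ 2)
    (hC1 : ∀ u, |u| ≤ |s| → ‖deriv (deriv X) (τs + u)‖ ≤ M / ℓ)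
    (hC2 : ∀ u, |u| ≤ |s| →
      ‖deriv (deriv X) (τs + u) - deriv (deriv X) τs‖ ≤ (M * |u| / ℓ + ε) / ℓ) :
    |(-3) * ((‖X τs - X (τs + s)‖ ^ 2 + 1) ^ (5 / 2 : ℝ))⁻¹ * ⟪X τs - X (τs + s), deriv X τs⟫ *
        ⟪cross (deriv X (τs + s)) (X τs - X (τs + s)), deriv X τs⟫| ≤
      10 * (M + 1) ^ 2 / (3 * ℓ ^ 3) + 20 * (M + 1) * ε / (3 * ℓ ^ 2) * (√(1 + s ^ 2))⁻¹ := by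
  have he : ‖(EuclideanSpace.single 2 1 : EuclideanSpace ℝ (Fin 3))‖ = 1 := by simp
  have hchord : 3 / 4 * s ^ 2 ≤ ‖X τs - X (τs + s)‖ ^ 2 := by
    rcases lt_trichotomy s 0 with hs | hs | hs
    · have h := sssf_chord hX he (show τs + s < τs by linarith) fun ξ hξ => by
        have hu : |ξ - τs| ≤ |s| := by rw [abs_of_neg hs, abs_le]; constructor <;> linarith [hξ.1, hξ.2]
        simpa only [add_sub_cancel] using hvert (ξ - τs) hu
      rwa [sub_add_cancel_left, neg_sq] at h
    · subst hs; simp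
    · have h := sssf_chord hX he (show τs < τs + s by linarith) fun ξ hξ => by
        have hu : |ξ - τs| ≤ |s| := by rw [abs_of_pos hs, abs_le]; constructor <;> linarith [hξ.1, hξ.2]
        simpa only [add_sub_cancel] using hvert (ξ - τs) hu
      rwa [add_sub_cancel_left, norm_sub_rev] at h
  set T₀ := deriv X τs with hT₀def
  set P := deriv X (τs + s) with hPdef
  set r := X τs - X (τs + s) with hrdef
  have hT₀ : ‖T₀‖ = 1 := hunit τs
  have hr : ‖r‖ ≤ |s| := by simpa [abs_neg] using sssf_lip hX hunit τs (τs + s)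
  have hB : |⟪cross P r, T₀⟫| ≤ (M + 1) ^ 2 / 2 * |s| ^ 4 / ℓ ^ 3 + (M + 1) * ε * |s| ^ 3 / ℓ ^ 2 := by
    have h := selfStrand_triple_le hX τs s hℓ hM hε hC1 hC2
    rw [hunit τs, one_mul] at h
    have hm := sssf_majorant_le (abs_nonneg s) hℓ hsℓ hM hε hε1
    simp only [sq_abs] at hm
    rw [hrdef, sssf_triple_identity P T₀ (X (τs + s)) (X τs) s, abs_neg]
    exact h.trans hm
  have hq : 0 < ‖r‖ ^ 2 + 1 := by positivity
  have hq52 : 0 < (‖r‖ ^ 2 + 1) ^ (5 / 2 : ℝ) := Real.rpow_pos_of_pos hq _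
  have h52 : (‖r‖ ^ 2 + 1) ^ (5 / 2 : ℝ) = (‖r‖ ^ 2 + 1) ^ 2 * √(‖r‖ ^ 2 + 1) := by
    rw [show (5 / 2 : ℝ) = 2 + 1 / 2 by norm_num, Real.rpow_add hq, Real.rpow_two, Real.sqrt_eq_rpow]
  have hker : 9 / 20 * ((1 + s ^ 2) ^ 2 * √(1 + s ^ 2)) ≤ (‖r‖ ^ 2 + 1) ^ (5 / 2 : ℝ) := by
    have h1 : 3 / 4 * (1 + s ^ 2) ≤ ‖r‖ ^ 2 + 1 := by linarith [hchord]
    have h2' : (4 / 5 * √(1 + s ^ 2)) ^ 2 ≤ ‖r‖ ^ 2 + 1 := by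
      rw [mul_pow, Real.sq_sqrt (by positivity)]; nlinarith [hchord, sq_nonneg s]
    have h2 := Real.abs_le_sqrt h2'
    rw [abs_of_nonneg (by positivity)] at h2
    calc 9 / 20 * ((1 + s ^ 2) ^ 2 * √(1 + s ^ 2)) = (3 / 4 * (1 + s ^ 2)) ^ 2 * (4 / 5 * √(1 + s ^ 2)) := by
          ring
      _ ≤ (‖r‖ ^ 2 + 1) ^ 2 * √(‖r‖ ^ 2 + 1) :=
          mul_le_mul (pow_le_pow_left₀ (by positivity) h1 2) h2 (by positivity) (by positivity)
      _ = _ := h52.symm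
  have hp : 0 < 1 + s ^ 2 := by positivity
  have ht4 : |s| ^ 4 ≤ (1 + s ^ 2) ^ 2 := by
    rw [show |s| ^ 4 = (s ^ 2) ^ 2 by rw [← sq_abs s]; ring]
    exact pow_le_pow_left₀ (sq_nonneg _) (by linarith [sq_nonneg s]) 2
  have ht5 : |s| ^ 5 ≤ (1 + s ^ 2) ^ 2 * √(1 + s ^ 2) := by
    rw [show |s| ^ 5 = |s| ^ 4 * |s| by ring]
    exact mul_le_mul ht4 (Real.abs_le_sqrt (by linarith)) (abs_nonneg _) (by positivity)
  have hinner : |⟪r, T₀⟫| ≤ |s| := (abs_real_inner_le_norm r T₀).trans (by rw [hT₀, mul_one]; exact hr)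
  have hw0 : 0 < √(1 + s ^ 2) := Real.sqrt_pos.2 hp
  set w := √(1 + s ^ 2) with hw
  set D := (1 + s ^ 2) ^ 2 * w with hD
  have hD0 : 0 < D := by positivity
  clear_value w D
  have hℓ0 : ℓ ≠ 0 := hℓ.ne'
  calc |(-3) * ((‖r‖ ^ 2 + 1) ^ (5 / 2 : ℝ))⁻¹ * ⟪r, T₀⟫ * ⟪cross P r, T₀⟫|
      = 3 * ((‖r‖ ^ 2 + 1) ^ (5 / 2 : ℝ))⁻¹ * |⟪r, T₀⟫| * |⟪cross P r, T₀⟫| := by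
        rw [abs_mul, abs_mul, abs_mul, abs_inv, abs_of_pos hq52, show |(-3 : ℝ)| = 3 by norm_num]
    _ ≤ 3 * (9 / 20 * D)⁻¹ * |s| * ((M + 1) ^ 2 / 2 * |s| ^ 4 / ℓ ^ 3 + (M + 1) * ε * |s| ^ 3 / ℓ ^ 2) := by
        gcongr
    _ = 20 / 3 * D⁻¹ * ((M + 1) ^ 2 / 2 * |s| ^ 5 / ℓ ^ 3 + (M + 1) * ε * |s| ^ 4 / ℓ ^ 2) := by ring
    _ ≤ 20 / 3 * D⁻¹ * ((M + 1) ^ 2 / 2 * D / ℓ ^ 3 + (M + 1) * ε * (1 + s ^ 2) ^ 2 / ℓ ^ 2) := by gcongr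
    _ = 10 * (M + 1) ^ 2 / (3 * ℓ ^ 3) + 20 * (M + 1) * ε / (3 * ℓ ^ 2) * w⁻¹ := by
        rw [hD]; field_simp; ring

/-- The window integral `∫_{τs−L}^{τs+L} (c₁ + c₂ (√(1+(σ−τs)²))⁻¹) dσ = 2Lc₁ + 2c₂ arsinh L`. [folklore] -/
private theorem sssf_window_integral (c₁ c₂ τs L : ℝ) :
    ∫ σ in (τs - L)..(τs + L), (c₁ + c₂ * (√(1 + (σ - τs) ^ 2))⁻¹) = 2 * L * c₁ + 2 * c₂ * Real.arsinh L := by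
  have h := intervalIntegral.integral_comp_sub_right (fun s => c₁ + c₂ * (√(1 + s ^ 2))⁻¹) τs
    (a := τs - L) (b := τs + L)
  simp only [sub_sub_cancel_left, add_sub_cancel_left] at h
  have hc : Continuous fun s : ℝ => (√(1 + s ^ 2))⁻¹ :=
    (Real.continuous_sqrt.comp (by fun_prop)).inv₀ fun s => (Real.sqrt_pos.2 (by positivity)).ne'
  have I2 : IntervalIntegrable (fun s : ℝ => c₂ * (√(1 + s ^ 2))⁻¹) volume (-L) L :=
    (continuous_const.mul hc).intervalIntegrable _ _
  rw [h, intervalIntegral.integral_add (continuous_const.intervalIntegrable _ _) I2,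
    intervalIntegral.integral_const, intervalIntegral.integral_const_mul,
    intervalIntegral.integral_eq_sub_of_hasDerivAt (fun x _ => Real.hasDerivAt_arsinh x)
      (hc.intervalIntegrable _ _), Real.arsinh_neg, smul_eq_mul]
  ring

/-- For `Γ ≥ 55` and `L ≤ √Γ`: `arsinh L ≤ log Γ` (`√Γ + √(1+Γ) ≤ Γ`). [folklore] -/
private theorem sssf_arsinh_le {Γ L : ℝ} (hΓ : 55 ≤ Γ) (hL : L ≤ √Γ) : Real.arsinh L ≤ Real.log Γ := by
  refine (Real.arsinh_le_arsinh.2 hL).trans ?_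
  rw [Real.arsinh, Real.sq_sqrt (by linarith)]
  apply Real.log_le_log (by positivity)
  have h2 : √Γ ≤ √(1 + Γ) := Real.sqrt_le_sqrt (by linarith)
  have h3 : √(1 + Γ) ≤ Γ / 2 := by rw [Real.sqrt_le_left (by positivity)]; nlinarith
  linarith

set_option maxHeartbeats 800000 in
/-- **Registered stub `stub_strainSelfFilament`** (D2, line `zero-accretion-selection`): the axial-strain
contribution of the filament through the stagnation point `x₀ = X τs` is integrable and bounded by
`(12C₀/R² + 9θC₀R/ρ′³ + 102(M+1)²ρ′/(log Γ)^{3/2} + 45(M+1)ε)/Γ` — far part (ToolsC tail bound),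
returning strands (chord–arc `(S)` + verticality), self window (coherent-bending cancellation of ToolsB
with the chord lower bound from verticality). [folklore] -/
theorem stub_strainSelfFilament :
    ∀ (X : ℝ → EuclideanSpace ℝ (Fin 3)) (τs C₀ Γ R ρ' θ M ε : ℝ), ContDiff ℝ 2 X → (∀ σ, ‖deriv X σ‖ = 1) → 0 ≤ C₀ → 55 ≤ Γ → 1 ≤ R →
      0 < ρ' → ρ' ≤ 1 / 2 → 0 ≤ θ → θ ≤ 1 / 2 → 0 ≤ M → 0 ≤ ε → ε ≤ 1 →
      (∀ D : ℝ, Real.sqrt Γ ≤ D → volume {σ : ℝ | ‖X σ - X τs‖ ≤ D} ≤ ENNReal.ofReal (C₀ * D)) →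
      (∀ σ, ‖X σ - X τs‖ ≤ R * Real.sqrt Γ → ‖cross (deriv X σ) (EuclideanSpace.single (2 : Fin 3) (1 : ℝ))‖ ≤ θ) →
      (∀ σ σ' : ℝ, ‖X σ - X τs‖ ≤ R * Real.sqrt Γ → ‖X σ' - X τs‖ ≤ R * Real.sqrt Γ →
        ‖deriv (deriv X) σ‖ * Real.sqrt (Γ * Real.log Γ / 2) ≤ M ∧
        ‖deriv (deriv X) σ - deriv (deriv X) σ'‖ * Real.sqrt (Γ * Real.log Γ / 2) ≤ M * |σ - σ'| / Real.sqrt (Γ * Real.log Γ / 2) + ε) →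
      (∀ σ σ' : ℝ, ‖X σ - X τs‖ ≤ R * Real.sqrt Γ → ‖X σ' - X τs‖ ≤ R * Real.sqrt Γ → ‖X σ - X σ'‖ < ρ' * Real.sqrt Γ → |σ - σ'| ≤ 2 * ‖X σ - X σ'‖) →
      Integrable (fun σ : ℝ => (-3) * ((‖X τs - X σ‖ ^ 2 + 1) ^ (5 / 2 : ℝ))⁻¹ * ⟪X τs - X σ, deriv X τs⟫ * ⟪cross (deriv X σ) (X τs - X σ), deriv X τs⟫) ∧
      |∫ σ : ℝ, (-3) * ((‖X τs - X σ‖ ^ 2 + 1) ^ (5 / 2 : ℝ))⁻¹ * ⟪X τs - X σ, deriv X τs⟫ * ⟪cross (deriv X σ) (X τs - X σ), deriv X τs⟫| ≤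
        (12 * C₀ / R ^ 2 + 9 * θ * C₀ * R / ρ' ^ 3 + 102 * (M + 1) ^ 2 * ρ' / Real.log Γ ^ (3 / 2 : ℝ) + 45 * (M + 1) * ε) / Γ := by
  intro X τs C₀ Γ R ρ' θ M ε hX hunit hC₀ hΓ hR hρ hρ2 hθ0 hθ2 hM hε0 hε1 hLR hV hC hS
  have hΓpos : 0 < Γ := by linarith
  have hG : 0 < √Γ := Real.sqrt_pos.2 hΓpos
  have hG1 : 1 ≤ √Γ := Real.one_le_sqrt.2 (by linarith)
  have hlog : 2 ≤ Real.log Γ := by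
    have h2 : Real.exp 2 = Real.exp 1 * Real.exp 1 := by rw [← Real.exp_add]; norm_num
    rw [Real.le_log_iff_exp_le hΓpos]; nlinarith [Real.exp_pos 1, Real.exp_one_lt_three]
  have hlogpos : 0 < Real.log Γ := by linarith
  set ℓ := √(Γ * Real.log Γ / 2) with hℓdef
  have hℓpos : 0 < ℓ := Real.sqrt_pos.2 (by positivity)
  have hℓsq : ℓ ^ 2 = Γ * Real.log Γ / 2 := Real.sq_sqrt (by positivity)
  have hGℓ : √Γ ≤ ℓ := Real.sqrt_le_sqrt (by nlinarith)
  set A := R * √Γ with hAdef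
  obtain ⟨hGA, hApos⟩ : √Γ ≤ A ∧ 0 < A := ⟨le_mul_of_one_le_left hG.le hR, hG.trans_le (le_mul_of_one_le_left hG.le hR)⟩
  set L := 2 * ρ' * √Γ with hLdef
  have hLG : L ≤ √Γ := by nlinarith [hG.le]
  obtain ⟨hLA, hLℓ⟩ : L ≤ A ∧ L ≤ ℓ := ⟨hLG.trans hGA, hLG.trans hGℓ⟩
  set T₀ := deriv X τs with hT₀def
  set e₃ : EuclideanSpace ℝ (Fin 3) := EuclideanSpace.single 2 1 with he₃def
  have he₃ : ‖e₃‖ = 1 := by simp [he₃def]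
  obtain ⟨hT₀, hτsball⟩ : ‖T₀‖ = 1 ∧ ‖X τs - X τs‖ ≤ A := ⟨hunit τs, by simp [hApos.le]⟩
  have hT₀vert : ‖cross T₀ e₃‖ ≤ θ := hV τs hτsball
  obtain ⟨hXc, hX'c⟩ : Continuous X ∧ Continuous (deriv X) := ⟨hX.continuous, hX.continuous_deriv (by norm_num)⟩
  set I : ℝ → ℝ := fun σ => (-3) * ((‖X τs - X σ‖ ^ 2 + 1) ^ (5 / 2 : ℝ))⁻¹ * ⟪X τs - X σ, T₀⟫ *
    ⟪cross (deriv X σ) (X τs - X σ), T₀⟫ with hIdef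
  set K : ℝ → ℝ := fun σ => ((‖X τs - X σ‖ ^ 2 + 1) ^ (3 / 2 : ℝ))⁻¹ with hKdef
  have hK0 : ∀ σ, 0 ≤ K σ := fun σ => inv_nonneg.2 (Real.rpow_nonneg (by positivity) _)
  have hIK : ∀ σ, |I σ| ≤ 3 * ‖cross (deriv X σ) T₀‖ * K σ := fun σ =>
    abs_axial_kernel_deriv_le (X τs - X σ) (deriv X σ) T₀ hT₀.le
  have hcross1 : ∀ σ, ‖cross (deriv X σ) T₀‖ ≤ 1 := fun σ => by
    simpa [hunit σ, hT₀] using norm_cross_le_norm_mul_norm (deriv X σ) T₀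
  have hI3K : ∀ σ, |I σ| ≤ 3 * K σ := fun σ =>
    (hIK σ).trans (mul_le_mul_of_nonneg_right (by nlinarith [hcross1 σ]) (hK0 σ))
  obtain ⟨hKint, hKfar⟩ : Integrable K ∧ (IntegrableOn K {σ | A ≤ ‖X σ - X τs‖} ∧
      ∫ σ in {σ | A ≤ ‖X σ - X τs‖}, K σ ≤ 4 * C₀ / A ^ 2) :=
    ⟨stub_tameVerticalToolsC.1 X (X τs) C₀ (√Γ) hXc hC₀ hG1 hLR,
      stub_tameVerticalToolsC.2 X (X τs) C₀ (√Γ) A hXc hC₀ hG1 hGA hLR⟩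
  have hIcont : Continuous I := by
    have hpos : ∀ σ, (0 : ℝ) < ‖X τs - X σ‖ ^ 2 + 1 := fun σ => by positivity
    refine ((continuous_const.mul (((((continuous_const.sub hXc).norm.pow 2).add continuous_const).rpow_const
      fun σ => Or.inl (hpos σ).ne').inv₀ fun σ => (Real.rpow_pos_of_pos (hpos σ) _).ne')).mul
      ((continuous_const.sub hXc).inner continuous_const)).mul ?_
    exact (crossCLM.continuous₂.comp₂ hX'c (continuous_const.sub hXc)).inner continuous_const
  have hIint : Integrable I := (hKint.const_mul 3).mono' hIcont.aestronglyMeasurable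
    (Filter.Eventually.of_forall fun σ => by rw [Real.norm_eq_abs]; exact hI3K σ)
  set Sfar : Set ℝ := {σ | A ≤ ‖X σ - X τs‖} with hSfar_def
  set W : Set ℝ := Ioo (τs - L) (τs + L) with hWdef
  have hSfar_m : MeasurableSet Sfar := measurableSet_le measurable_const (hXc.sub continuous_const).norm.measurable
  have hW_m : MeasurableSet W := measurableSet_Ioo
  have hWsub : W ⊆ Sfarᶜ := fun σ hσ => by
    simp only [hWdef, mem_Ioo, hSfar_def, mem_compl_iff, mem_setOf_eq, not_le] at hσ ⊢
    have h2 : |σ - τs| < L := abs_sub_lt_iff.2 ⟨by linarith only [hσ.2], by linarith only [hσ.1]⟩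
    linarith only [sssf_lip hX hunit σ τs, h2, hLA]
  have hfar : |∫ σ in Sfar, I σ| ≤ 12 * C₀ / (R ^ 2 * Γ) := by
    have h1 : ‖∫ σ in Sfar, I σ‖ ≤ ∫ σ in Sfar, 3 * K σ := norm_integral_le_of_norm_le (hKfar.1.const_mul 3)
      (Filter.Eventually.of_forall fun σ => by rw [Real.norm_eq_abs]; exact hI3K σ)
    rw [Real.norm_eq_abs, integral_const_mul] at h1
    refine h1.trans ?_
    calc 3 * ∫ σ in Sfar, K σ ≤ 3 * (4 * C₀ / A ^ 2) := by gcongr; exact hKfar.2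
      _ = 12 * C₀ / (R ^ 2 * Γ) := by rw [hAdef, mul_pow, Real.sq_sqrt hΓpos.le]; ring
  have hmid : |∫ σ in Sfarᶜ \ W, I σ| ≤ 9 * θ * C₀ * R / (ρ' ^ 3 * Γ) := by
    clear hfar
    have hρG : 0 < ρ' * √Γ := by positivity
    have hsub : Sfarᶜ \ W ⊆ {σ | ‖X σ - X τs‖ ≤ A} := fun σ hσ => by
      simp only [hSfar_def, mem_sdiff, mem_compl_iff, mem_setOf_eq, not_le] at hσ ⊢
      exact hσ.1.le
    have hpt : ∀ σ ∈ Sfarᶜ \ W, ‖I σ‖ ≤ 9 * θ * ((ρ' * √Γ) ^ 3)⁻¹ := by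
      intro σ hσ
      have hball : ‖X σ - X τs‖ ≤ A := hsub hσ
      simp only [hWdef, mem_sdiff, mem_Ioo, not_and, not_lt] at hσ
      have hfarself : ρ' * √Γ ≤ ‖X τs - X σ‖ := by
        by_contra hlt
        rw [not_le, norm_sub_rev] at hlt
        have h1 := hS σ τs hball hτsball hlt
        have h2 : |σ - τs| < L := by rw [hLdef]; linarith only [h1, hlt]
        rw [abs_sub_lt_iff] at h2
        linarith only [hσ.2 (by linarith only [h2.2]), h2.1]
      have htilt : ‖cross (deriv X σ) T₀‖ ≤ 3 * θ := by
        have := norm_cross_le_of_near_axis (deriv X σ) T₀ e₃ (hunit σ) hT₀ he₃ (hV σ hball) hT₀vert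
        nlinarith
      rw [Real.norm_eq_abs]
      calc |I σ| ≤ 3 * ‖cross (deriv X σ) T₀‖ * K σ := hIK σ
        _ ≤ 3 * (3 * θ) * ((ρ' * √Γ) ^ 3)⁻¹ :=
          mul_le_mul (by linarith only [htilt]) (sssf_kernel_le_of_le hρG hfarself) (hK0 σ) (by positivity)
        _ = 9 * θ * ((ρ' * √Γ) ^ 3)⁻¹ := by ring
    have hvol : volume (Sfarᶜ \ W) ≤ ENNReal.ofReal (C₀ * A) := (measure_mono hsub).trans (hLR A hGA)
    have h := norm_setIntegral_le_of_norm_le_const (hvol.trans_lt ENNReal.ofReal_lt_top) hpt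
    rw [Real.norm_eq_abs] at h
    refine h.trans ?_
    calc 9 * θ * ((ρ' * √Γ) ^ 3)⁻¹ * volume.real (Sfarᶜ \ W) ≤ 9 * θ * ((ρ' * √Γ) ^ 3)⁻¹ * (C₀ * A) := by
          gcongr; exact ENNReal.toReal_le_of_le_ofReal (by positivity) hvol
      _ = 9 * θ * C₀ * R / (ρ' ^ 3 * Γ) := by
          rw [hAdef, mul_pow, show (√Γ) ^ 3 = Γ * √Γ by rw [pow_succ, Real.sq_sqrt hΓpos.le]]
          field_simp
  have hwin : |∫ σ in W, I σ| ≤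
      40 * (M + 1) ^ 2 * ρ' / (Real.log Γ ^ (3 / 2 : ℝ) * Γ) + 80 / 3 * (M + 1) * ε / Γ := by
    clear hfar hmid
    have key : ∀ s : ℝ, |s| < L → |I (τs + s)| ≤
        10 * (M + 1) ^ 2 / (3 * ℓ ^ 3) + 20 * (M + 1) * ε / (3 * ℓ ^ 2) * (√(1 + s ^ 2))⁻¹ := by
      intro s hs
      have hball : ∀ u, |u| ≤ |s| → ‖X (τs + u) - X τs‖ ≤ A := fun u hu => by
        have := sssf_lip hX hunit (τs + u) τs
        rw [add_sub_cancel_left] at this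
        linarith only [this, hu, hs, hLA]
      refine sssf_window_pointwise hX hunit hℓpos hM hε0 hε1 (hs.le.trans hLℓ)
        (fun u hu => sssf_height_sq (hunit _) he₃ hθ2 (hV _ (hball u hu))) (fun u hu => ?_) (fun u hu => ?_)
      · rw [le_div_iff₀ hℓpos]
        exact (hC (τs + u) τs (hball u hu) hτsball).1
      · have h := (hC (τs + u) τs (hball u hu) hτsball).2
        rw [add_sub_cancel_left] at h
        rwa [le_div_iff₀ hℓpos]
    have hpt : ∀ σ ∈ W, ‖I σ‖ ≤
        10 * (M + 1) ^ 2 / (3 * ℓ ^ 3) + 20 * (M + 1) * ε / (3 * ℓ ^ 2) * (√(1 + (σ - τs) ^ 2))⁻¹ := by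
      intro σ hσ
      simp only [hWdef, mem_Ioo] at hσ
      have h := key (σ - τs) (abs_sub_lt_iff.2 ⟨by linarith only [hσ.2], by linarith only [hσ.1]⟩)
      rwa [add_sub_cancel, ← Real.norm_eq_abs] at h
    have hL0 : 0 ≤ L := by rw [hLdef]; positivity
    have hsq : Continuous fun σ : ℝ => (√(1 + (σ - τs) ^ 2))⁻¹ :=
      (Real.continuous_sqrt.comp (by fun_prop : Continuous fun σ : ℝ => 1 + (σ - τs) ^ 2)).inv₀
        fun σ => (Real.sqrt_pos.2 (by positivity)).ne'
    have hWint : IntegrableOn (fun σ : ℝ =>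
        10 * (M + 1) ^ 2 / (3 * ℓ ^ 3) + 20 * (M + 1) * ε / (3 * ℓ ^ 2) * (√(1 + (σ - τs) ^ 2))⁻¹) W :=
      ((continuous_const.add (continuous_const.mul hsq)).integrableOn_Icc (a := τs - L) (b := τs + L)).mono_set
        Ioo_subset_Icc_self
    have h1 := norm_integral_le_of_norm_le hWint ((ae_restrict_iff' hW_m).2 (Filter.Eventually.of_forall hpt))
    rw [Real.norm_eq_abs] at h1
    refine h1.trans ?_
    rw [hWdef, ← integral_Ioc_eq_integral_Ioo, ← intervalIntegral.integral_of_le (by linarith only [hL0]),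
      sssf_window_integral]
    have hlog32 : Real.log Γ ^ (3 / 2 : ℝ) = Real.log Γ * √(Real.log Γ) := by
      rw [show (3 / 2 : ℝ) = 1 + 1 / 2 by norm_num, Real.rpow_add hlogpos, Real.rpow_one, Real.sqrt_eq_rpow]
    have hGΛ : √Γ * √(Real.log Γ) ≤ 3 / 2 * ℓ := by
      rw [← pow_le_pow_iff_left₀ (by positivity) (by positivity) two_ne_zero, mul_pow,
        Real.sq_sqrt hΓpos.le, Real.sq_sqrt hlogpos.le, mul_pow, hℓsq]
      nlinarith only [mul_pos hΓpos hlogpos]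
    have hℓ3 : √Γ * (Real.log Γ * √(Real.log Γ)) * Γ ≤ 3 * ℓ ^ 3 := by
      calc √Γ * (Real.log Γ * √(Real.log Γ)) * Γ = (√Γ * √(Real.log Γ)) * (Γ * Real.log Γ) := by ring
        _ ≤ (3 / 2 * ℓ) * (2 * ℓ ^ 2) := mul_le_mul hGΛ (le_of_eq (by rw [hℓsq]; ring)) (by positivity) (by positivity)
        _ = 3 * ℓ ^ 3 := by ring
    have hterm1 : 2 * L * (10 * (M + 1) ^ 2 / (3 * ℓ ^ 3)) ≤
        40 * (M + 1) ^ 2 * ρ' / (Real.log Γ ^ (3 / 2 : ℝ) * Γ) := by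
      rw [hlog32, hLdef, le_div_iff₀ (by positivity)]
      calc 2 * (2 * ρ' * √Γ) * (10 * (M + 1) ^ 2 / (3 * ℓ ^ 3)) * (Real.log Γ * √(Real.log Γ) * Γ)
          = 40 * (M + 1) ^ 2 * ρ' / (3 * ℓ ^ 3) * (√Γ * (Real.log Γ * √(Real.log Γ)) * Γ) := by ring
        _ ≤ 40 * (M + 1) ^ 2 * ρ' / (3 * ℓ ^ 3) * (3 * ℓ ^ 3) := by gcongr
        _ = 40 * (M + 1) ^ 2 * ρ' := by field_simp
    have hterm2 : 2 * (20 * (M + 1) * ε / (3 * ℓ ^ 2)) * Real.arsinh L ≤ 80 / 3 * (M + 1) * ε / Γ := by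
      calc 2 * (20 * (M + 1) * ε / (3 * ℓ ^ 2)) * Real.arsinh L
          ≤ 2 * (20 * (M + 1) * ε / (3 * ℓ ^ 2)) * Real.log Γ := by gcongr; exact sssf_arsinh_le hΓ hLG
        _ = 80 / 3 * (M + 1) * ε / Γ := by rw [hℓsq]; field_simp; ring
    linarith only [hterm1, hterm2]
  refine ⟨hIint, ?_⟩
  rw [← integral_add_compl hSfar_m hIint,
    sub_eq_iff_eq_add.1 (setIntegral_sdiff hW_m hIint.integrableOn hWsub).symm]
  have hΛpos : 0 < Real.log Γ ^ (3 / 2 : ℝ) := Real.rpow_pos_of_pos hlogpos _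
  calc |(∫ σ in Sfar, I σ) + ((∫ σ in Sfarᶜ \ W, I σ) + ∫ σ in W, I σ)|
      ≤ |∫ σ in Sfar, I σ| + (|∫ σ in Sfarᶜ \ W, I σ| + |∫ σ in W, I σ|) :=
        (abs_add_le _ _).trans (add_le_add le_rfl (abs_add_le _ _))
    _ ≤ 12 * C₀ / (R ^ 2 * Γ) + (9 * θ * C₀ * R / (ρ' ^ 3 * Γ) +
          (40 * (M + 1) ^ 2 * ρ' / (Real.log Γ ^ (3 / 2 : ℝ) * Γ) + 80 / 3 * (M + 1) * ε / Γ)) :=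
        add_le_add hfar (add_le_add hmid hwin)
    _ = (12 * C₀ / R ^ 2 + 9 * θ * C₀ * R / ρ' ^ 3 + 40 * (M + 1) ^ 2 * ρ' / Real.log Γ ^ (3 / 2 : ℝ) +
          80 / 3 * (M + 1) * ε) / Γ := by
        field_simp
        ring
    _ ≤ _ := by
        apply div_le_div_of_nonneg_right _ hΓpos.le
        have h1 : 40 * (M + 1) ^ 2 * ρ' / Real.log Γ ^ (3 / 2 : ℝ) ≤
            102 * (M + 1) ^ 2 * ρ' / Real.log Γ ^ (3 / 2 : ℝ) := by gcongr; norm_num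
        have h2 : 80 / 3 * (M + 1) * ε ≤ 45 * (M + 1) * ε := by gcongr; norm_num
        linarith only [h1, h2]

end Summit.NavierStokesRegularity.NavierStokesRegularity.Theorems.SkeletonEquilibrium.ZeroAccretionSelection
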